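import Mathlib
import HarnessLib

/-!
# Positive semidefinite completion along a chordal pattern (Grone–Johnson–Sá–Wolkowicz)

The existence half of the POSITIVE SEMIDEFINITE COMPLETION theorem — the dual face of the
chordal clique decomposition (`Literature.Analysis.Matrix.ChordalSparsityDecomposition`) and the
fact behind "range-space" / dual conversion of sparse semidefinite programs: a partial Hermitian
matrix whose specified entries form a CHORDAL pattern and whose fully specified principal
(clique) blocks are all positive semidefinite can be completed to a positive semidefinite matrix.

> [GJSW, §5 p. 118] *`A(G)` is a G-partial positive (nonnegative) matrix if `a_{ij} = \bar a_{ji}`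
> for all `{i,j} ∈ E` and for any clique `C` of `G` the principal submatrix `[a_{ij} : i, j ∈ C]`
> of `A(G)` is positive definite (positive semidefinite). […] We say that the graph `G` is
> completable (nonnegative-completable) if and only if any G-partial positive (G-partial
> nonnegative) matrix has a positive (nonnegative) completion.*
>
> [GJSW, §5 Prop. 2, p. 119] *`G` is completable if and only if `G` is nonnegative-completable.*
>
> [GJSW, §6 Thm 7, p. 120] *`G` is completable if and only if `G` is chordal.*
> (Proof of "if", p. 122: fill the missing entries one at a time along a sequence of chordal
> graphs `G = G₀ ⊂ G₁ ⊂ ⋯ ⊂ G_s = K_n` [Lemma 4]; each step lives in a single maximal clique and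
> reduces to the band case (6.1) = [GJSW, Thm 1] (Dym–Gohberg).  §7, pp. 122–123: "`A` can be
> completed to a positive definite (or semidefinite) matrix by filling up the empty positions of
> `A` sequentially".)

(page check: held text `paper:doi-10-1016-0024-3795-84-90207-6` p. 110 (Thm 1 [Dym–Gohberg]),
p. 118 (§5: G-partial positive / nonnegative matrix, completable), p. 119 (Props. 1, 2; §6
chordal graphs, perfect elimination orderings, Thm 6), p. 120 (Thm 7, Lemmas 3–4), p. 122 (proof
of Thm 7 "if"; §7 the completion process), p. 123; running intersection property:
galaxy `pdf:-524676218741277540` = [BP] p. 11 Thm 3.1, p. 13 §3.3 (3.1), p. 14 Thm 3.4.)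

## Formalisation choices

As in `ChordalSparsityDecomposition`, chordality is presented through a clique sequence
`C 0, …, C (m-1) : Set ι` with the RUNNING INTERSECTION PROPERTY `hrip` ([BP, Thms 3.1, 3.4]:
exactly the orderings of the maximal cliques of chordal graphs along a clique tree), the
partial matrix is an ordinary `A : Matrix ι ι 𝕜` of which only the entries in some `C k × C k`
are regarded as specified, and "G-partial nonnegative" is the hypothesis that every clique block
`A.submatrix (↑) (↑) : Matrix (C k) (C k) 𝕜` is positive semidefinite.  We formalise the
NONNEGATIVE (positive semidefinite) version, which by [GJSW, Prop. 2] is equivalent to the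
positive definite one; `𝕜 = ℝ` or `ℂ` (`RCLike`).  The induction is organised clique-by-clique
(rather than entry-by-entry as in [GJSW]): the step is the two-block AMALGAMATION lemma
`exists_posSemidef_glue`, proved by gluing Gram representations in a Hilbert direct sum (so no
invertibility / Schur complements are needed).  The converse "only if" of Thm 7 (a non-chordal
pattern carries a partial PSD matrix without PSD completion, [GJSW, Lemmas 5–6]) is a statement
about graphs and is not formalised; the trivial necessity of the clique conditions is
`posSemidef_submatrix_of_completion`.

## Main statements (namespace `Literature.Analysis.Matrix.ChordalCompletion`)

* `exists_posSemidef_glue` — **two cliques** ([GJSW, Thm 7] for the pattern `(s × s) ∪ (t × t)`):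
  `G₁ ⪰ 0` on `s × s`, `G₂ ⪰ 0` on `t × t`, equal on the overlap ⟹ one `W ⪰ 0` on `ι × ι`
  restricting to both.
* `exists_posSemidef_completion_of_rip` — **[GJSW, Thm 7 "if"; Prop. 2]**: a partial PSD matrix
  on a running-intersection (chordal) clique pattern has a PSD completion.
* `posSemidef_submatrix_of_completion` — the trivial converse of the clique conditions.
* `exists_fromBlocks₃_posSemidef` — display form with one unspecified corner:
  `[[A, B], [Bᴴ, X]] ⪰ 0 ∧ [[X, D], [Dᴴ, E]] ⪰ 0 ⟹ ∃ Z, [[A, B, Z], [Bᴴ, X, D], [Zᴴ, Dᴴ, E]] ⪰ 0`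
  (the band pattern of [GJSW, (6.1)] with three block-diagonals).

All statements are theorems (no named facts); standard axioms.

## References

* [GJSW] R. Grone, C. R. Johnson, E. M. Sá, H. Wolkowicz, *Positive definite completions of
  partial Hermitian matrices*, Linear Algebra Appl. 58 (1984) 109–124, §5 (Props. 1–2), §6
  (Thm 7, Lemmas 3–6), §7 (bib: GroneEtAl1984).
* H. Dym, I. Gohberg, *Extensions of band matrices with band inverses*, Linear Algebra Appl. 36
  (1981) 1–24 (= [GJSW, ref. 1, Thm 1]; not held, cited through [GJSW]).
* [BP] J. R. S. Blair, B. Peyton, *An introduction to chordal graphs and clique trees*, in: Graph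
  Theory and Sparse Matrix Computation, IMA Vol. 56, Springer (1993) 1–29, Thm 3.1, §3.3 (3.1),
  Thm 3.4 (bib: BlairPeyton1993).
* [AHMR] J. Agler, J. W. Helton, S. McCullough, L. Rodman, *Positive semidefinite matrices with a
  given sparsity pattern*, Linear Algebra Appl. 107 (1988) 101–149 — the dual (decomposition)
  statement, `Literature.Analysis.Matrix.ChordalSparsityDecomposition` (bib: AglerEtAl1988).
* L. Vandenberghe, M. S. Andersen, *Chordal graphs and semidefinite optimization*, Found. Trends
  Optim. 1 (2015) 241–433 (bib: VandenbergheAndersen2015; not held — provenance of the SDP usage).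
-/

noncomputable section

open scoped Matrix MatrixOrder ComplexOrder InnerProductSpace

namespace Literature.Analysis.Matrix.ChordalCompletion

variable {𝕜 : Type*} [RCLike 𝕜]

/-! ### Plumbing: Gram vectors, equal Gram matrices, orthogonal splitting -/

section plumbing

/-- A positive semidefinite matrix is a Gram matrix: `M i j = ⟪vᵢ, vⱼ⟫` for the columns `vⱼ` of
any `B` with `M = Bᴴ B`. [folklore] -/
private theorem exists_gram {n : Type*} [Fintype n] [DecidableEq n] {M : Matrix n n 𝕜}
    (hM : M.PosSemidef) : ∃ v : n → EuclideanSpace 𝕜 n, ∀ i j, M i j = ⟪v i, v j⟫_𝕜 := by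
  obtain ⟨B, hB⟩ : ∃ B : Matrix n n 𝕜, M = star B * B :=
    CStarAlgebra.nonneg_iff_eq_star_mul_self.mp hM.nonneg
  refine ⟨fun j => WithLp.toLp 2 fun k => B k j, fun i j => ?_⟩
  rw [hB, Matrix.star_eq_conjTranspose, Matrix.mul_apply]
  simp only [EuclideanSpace.inner_toLp_toLp, dotProduct, Matrix.conjTranspose_apply,
    Pi.star_apply]
  exact Finset.sum_congr rfl fun k _ => mul_comm _ _

variable {E E' : Type*} [NormedAddCommGroup E] [InnerProductSpace 𝕜 E] [NormedAddCommGroup E']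
  [InnerProductSpace 𝕜 E']

/-- Two families with the same Gram matrix are related by a linear isometry defined on a
subspace containing the first family (its span, presented as the range of
`Finsupp.linearCombination`). [folklore] -/
private theorem exists_linearIsometry_of_inner_eq {κ : Type*} (a : κ → E) (b : κ → E')
    (h : ∀ i j, ⟪a i, a j⟫_𝕜 = ⟪b i, b j⟫_𝕜) :
    ∃ (S : Submodule 𝕜 E) (φ : S →ₗᵢ[𝕜] E') (hS : ∀ i, a i ∈ S), ∀ i, φ ⟨a i, hS i⟩ = b i := by
  have hinner : ∀ c d : κ →₀ 𝕜, ⟪Finsupp.linearCombination 𝕜 a c,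
      Finsupp.linearCombination 𝕜 a d⟫_𝕜 =
      ⟪Finsupp.linearCombination 𝕜 b c, Finsupp.linearCombination 𝕜 b d⟫_𝕜 := by
    intro c d
    simp only [Finsupp.linearCombination_apply, Finsupp.sum, sum_inner, inner_sum,
      inner_smul_left, inner_smul_right, h]
  have hker : LinearMap.ker (Finsupp.linearCombination 𝕜 a) ≤
      LinearMap.ker (Finsupp.linearCombination 𝕜 b) := by
    intro c hc
    rw [LinearMap.mem_ker] at hc ⊢
    rw [← @inner_self_eq_zero 𝕜, ← hinner, hc, inner_zero_left]
  let φ₀ : LinearMap.range (Finsupp.linearCombination 𝕜 a) →ₗ[𝕜] E' :=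
    ((LinearMap.ker (Finsupp.linearCombination 𝕜 a)).liftQ (Finsupp.linearCombination 𝕜 b)
      hker).comp (Finsupp.linearCombination 𝕜 a).quotKerEquivRange.symm.toLinearMap
  have hφ₀ : ∀ c, φ₀ ⟨Finsupp.linearCombination 𝕜 a c, LinearMap.mem_range_self _ c⟩ =
      Finsupp.linearCombination 𝕜 b c := by
    intro c
    simp only [φ₀, LinearMap.comp_apply, LinearEquiv.coe_toLinearMap,
      LinearMap.quotKerEquivRange_symm_apply_image, Submodule.mkQ_apply, Submodule.liftQ_apply]
  have hiso : ∀ u v, ⟪φ₀ u, φ₀ v⟫_𝕜 = ⟪u, v⟫_𝕜 := by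
    intro u v
    obtain ⟨c, hc⟩ := u.2
    obtain ⟨d, hd⟩ := v.2
    have hu : u = ⟨Finsupp.linearCombination 𝕜 a c, LinearMap.mem_range_self _ c⟩ :=
      Subtype.ext hc.symm
    have hv : v = ⟨Finsupp.linearCombination 𝕜 a d, LinearMap.mem_range_self _ d⟩ :=
      Subtype.ext hd.symm
    rw [hu, hv, hφ₀, hφ₀, Submodule.coe_inner, ← hinner]
  have hmem : ∀ i, a i ∈ LinearMap.range (Finsupp.linearCombination 𝕜 a) := fun i =>
    ⟨Finsupp.single i 1, by simp [Finsupp.linearCombination_single]⟩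
  refine ⟨LinearMap.range (Finsupp.linearCombination 𝕜 a), φ₀.isometryOfInner hiso, hmem,
    fun i => ?_⟩
  rw [LinearMap.coe_isometryOfInner]
  have he : (⟨a i, hmem i⟩ : LinearMap.range (Finsupp.linearCombination 𝕜 a)) =
      ⟨Finsupp.linearCombination 𝕜 a (Finsupp.single i 1), LinearMap.mem_range_self _ _⟩ :=
    Subtype.ext (by simp [Finsupp.linearCombination_single])
  rw [he, hφ₀, Finsupp.linearCombination_single, one_smul]

/-- `⟪x, y⟫ = ⟪P x, P y⟫ + ⟪x - P x, y - P y⟫` for an orthogonal projection `P`. [folklore] -/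
private theorem inner_eq_starProjection_add (K : Submodule 𝕜 E) [K.HasOrthogonalProjection]
    (x y : E) : ⟪x, y⟫_𝕜 = ⟪K.starProjection x, K.starProjection y⟫_𝕜 +
      ⟪x - K.starProjection x, y - K.starProjection y⟫_𝕜 := by
  have h1 : ⟪x - K.starProjection x, K.starProjection y⟫_𝕜 = 0 :=
    Submodule.starProjection_inner_eq_zero _ _ (Submodule.starProjection_apply_mem K y)
  have h2 : ⟪K.starProjection x, y - K.starProjection y⟫_𝕜 = 0 := by
    rw [← inner_conj_symm, Submodule.starProjection_inner_eq_zero _ _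
      (Submodule.starProjection_apply_mem K x), map_zero]
  calc ⟪x, y⟫_𝕜 = ⟪K.starProjection x + (x - K.starProjection x),
        K.starProjection y + (y - K.starProjection y)⟫_𝕜 := by rw [add_sub_cancel, add_sub_cancel]
    _ = _ := by rw [inner_add_left, inner_add_right, inner_add_right, h1, h2, add_zero, zero_add]

end plumbing

/-! ### Gluing two positive semidefinite blocks along their overlap -/

variable {ι : Type*} [Fintype ι] [DecidableEq ι]

/-- **Two-clique PSD completion (amalgamation).**  Let `s, t ⊆ ι`, let `G₁` be positive
semidefinite on `s × s` and `G₂` positive semidefinite on `t × t`, and suppose they agree on the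
overlap `(s ∩ t) × (s ∩ t)`.  Then there is ONE positive semidefinite `W` on `ι × ι` with
`W = G₁` on `s × s` and `W = G₂` on `t × t` — a PSD completion of the partial matrix specified on
the two-clique (hence chordal) pattern `(s × s) ∪ (t × t)`.  Proof (Hilbert-space amalgamation):
Gram vectors `xᵢ` (`i ∈ s`) of `G₁` and `yⱼ` (`j ∈ t`) of `G₂`; the overlap vectors have equal
Gram matrices, so `y_i ↦ x_i` (`i ∈ s ∩ t`) extends to a linear isometry `φ` on their span `S`;
with `P` the orthogonal projection onto `S`, the family `(xᵢ, 0)` (`i ∈ s`),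
`(φ(P yⱼ), yⱼ - P yⱼ)` (`j ∈ t ∖ s`) in `E₁ ⊕ E₂` has the required Gram matrix.
[cite: GroneEtAl1984, Thm 7 ('if') for two maximal cliques; §5 Prop. 2] -/
theorem exists_posSemidef_glue (s t : Set ι) (G₁ G₂ : Matrix ι ι 𝕜)
    (h₁ : (G₁.submatrix (Subtype.val : s → ι) Subtype.val).PosSemidef)
    (h₂ : (G₂.submatrix (Subtype.val : t → ι) Subtype.val).PosSemidef)
    (hagree : ∀ i, i ∈ s → i ∈ t → ∀ j, j ∈ s → j ∈ t → G₁ i j = G₂ i j) :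
    ∃ W : Matrix ι ι 𝕜, W.PosSemidef ∧ (∀ i ∈ s, ∀ j ∈ s, W i j = G₁ i j) ∧
      (∀ i ∈ t, ∀ j ∈ t, W i j = G₂ i j) := by
  classical
  obtain ⟨x, hx⟩ := exists_gram h₁
  obtain ⟨y, hy⟩ := exists_gram h₂
  simp only [Matrix.submatrix_apply] at hx hy
  -- the overlap, seen from `t`, and the two overlap families
  let a : {i : t // (i : ι) ∈ s} → EuclideanSpace 𝕜 t := fun i => y i.1
  let b : {i : t // (i : ι) ∈ s} → EuclideanSpace 𝕜 s := fun i => x ⟨(i.1 : ι), i.2⟩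
  have hab : ∀ i j, ⟪a i, a j⟫_𝕜 = ⟪b i, b j⟫_𝕜 := by
    intro i j
    simp only [a, b]
    rw [← hy, ← hx]
    exact (hagree _ i.2 i.1.2 _ j.2 j.1.2).symm
  obtain ⟨S, φ, hmemS, hφa⟩ := exists_linearIsometry_of_inner_eq a b hab
  haveI : CompleteSpace S := FiniteDimensional.complete 𝕜 S
  have hPa : ∀ i, S.starProjection (a i) = a i := fun i =>
    Submodule.starProjection_eq_self_iff.mpr (hmemS i)
  -- the glued family in the Hilbert sum `E₁ ⊕ E₂`
  let w : ι → WithLp 2 (EuclideanSpace 𝕜 s × EuclideanSpace 𝕜 t) := fun i =>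
    if hi : i ∈ s then WithLp.toLp 2 (x ⟨i, hi⟩, 0)
    else if hi' : i ∈ t then WithLp.toLp 2
      (φ ⟨S.starProjection (y ⟨i, hi'⟩), Submodule.starProjection_apply_mem S _⟩,
        y ⟨i, hi'⟩ - S.starProjection (y ⟨i, hi'⟩))
    else 0
  refine ⟨Matrix.gram 𝕜 w, Matrix.posSemidef_gram 𝕜 w, fun i hi j hj => ?_, fun i hi j hj => ?_⟩
  · rw [Matrix.gram_apply]
    simp only [w, dif_pos hi, dif_pos hj, WithLp.prod_inner_apply, inner_zero_left, add_zero]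
    exact (hx ⟨i, hi⟩ ⟨j, hj⟩).symm
  · rw [Matrix.gram_apply]
    by_cases his : i ∈ s <;> by_cases hjs : j ∈ s
    · simp only [w, dif_pos his, dif_pos hjs, WithLp.prod_inner_apply, inner_zero_left, add_zero]
      rw [← hx]
      exact hagree i his hi j hjs hj
    · simp only [w, dif_pos his, dif_neg hjs, dif_pos hj, WithLp.prod_inner_apply,
        inner_zero_left, add_zero]
      have hxi : x ⟨i, his⟩ = φ ⟨a ⟨⟨i, hi⟩, his⟩, hmemS _⟩ := (hφa ⟨⟨i, hi⟩, his⟩).symm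
      rw [hxi, LinearIsometry.inner_map_map φ, Submodule.coe_inner,
        ← Submodule.inner_starProjection_left_eq_right, hPa]
      exact (hy ⟨i, hi⟩ ⟨j, hj⟩).symm
    · simp only [w, dif_neg his, dif_pos hi, dif_pos hjs, WithLp.prod_inner_apply]
      have hxj : x ⟨j, hjs⟩ = φ ⟨a ⟨⟨j, hj⟩, hjs⟩, hmemS _⟩ := (hφa ⟨⟨j, hj⟩, hjs⟩).symm
      rw [hxj, LinearIsometry.inner_map_map φ, Submodule.coe_inner,
        Submodule.inner_starProjection_left_eq_right, hPa]
      simp only [inner_zero_right, add_zero]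
      exact (hy ⟨i, hi⟩ ⟨j, hj⟩).symm
    · simp only [w, dif_neg his, dif_pos hi, dif_neg hjs, dif_pos hj, WithLp.prod_inner_apply]
      rw [LinearIsometry.inner_map_map φ, Submodule.coe_inner, ← inner_eq_starProjection_add]
      exact (hy ⟨i, hi⟩ ⟨j, hj⟩).symm

/-! ### Completion along a running-intersection clique sequence -/

/-- **Grone–Johnson–Sá–Wolkowicz PSD completion** [GJSW, Thm 7 "if", in the nonnegative form of
§5 Prop. 2], running-intersection version: let `C 0, …, C (m-1) ⊆ ι` be cliques with the running
intersection property (by [BP, Thms 3.1, 3.4] exactly the maximal-clique sequences of chordal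
graphs), and let the partial matrix `A` — specified on the pattern `⋃ₖ C k × C k` — be *partial
positive semidefinite*: every clique block `A[C k]` is PSD.  Then `A` has a positive semidefinite
completion: a PSD `Z` agreeing with `A` on every specified entry.  (Induction on `m`: glue the
completion of the first `m` cliques with the block `A[C m]` by `exists_posSemidef_glue`; running
intersection says the overlap lies in one earlier clique, where the two agree.)
[cite: GroneEtAl1984, Thm 7 ('if'); §5 Prop. 2; §7] -/
theorem exists_posSemidef_completion_of_rip (A : Matrix ι ι 𝕜) (C : ℕ → Set ι) (m : ℕ)
    (hrip : ∀ k, 0 < k → k < m → ∃ p < k, ∀ i ∈ C k, (∃ j < k, i ∈ C j) → i ∈ C p)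
    (hA : ∀ k < m, (A.submatrix (Subtype.val : C k → ι) Subtype.val).PosSemidef) :
    ∃ Z : Matrix ι ι 𝕜, Z.PosSemidef ∧ ∀ i j, (∃ k < m, i ∈ C k ∧ j ∈ C k) → Z i j = A i j := by
  induction m with
  | zero =>
    exact ⟨0, Matrix.PosSemidef.zero, fun i j ⟨k, hk, _⟩ => absurd hk (Nat.not_lt_zero k)⟩
  | succ m ih =>
    obtain ⟨Z, hZ, hZA⟩ := ih (fun k hk hkm => hrip k hk (Nat.lt_succ_of_lt hkm))
      (fun k hk => hA k (Nat.lt_succ_of_lt hk))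
    obtain ⟨W, hW, hW₁, hW₂⟩ := exists_posSemidef_glue {i | ∃ k < m, i ∈ C k} (C m) Z A
      (hZ.submatrix _) (hA m (Nat.lt_succ_self m)) (by
        rintro i ⟨ki, hki, hi⟩ hit j ⟨kj, hkj, hj⟩ hjt
        have hm : 0 < m := by omega
        obtain ⟨p, hp, hCp⟩ := hrip m hm (Nat.lt_succ_self m)
        exact hZA i j ⟨p, hp, hCp i hit ⟨ki, hki, hi⟩, hCp j hjt ⟨kj, hkj, hj⟩⟩)
    refine ⟨W, hW, fun i j => ?_⟩
    rintro ⟨k, hk, hik, hjk⟩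
    rcases Nat.lt_succ_iff_lt_or_eq.mp hk with hk | rfl
    · rw [hW₁ i ⟨k, hk, hik⟩ j ⟨k, hk, hjk⟩]
      exact hZA i j ⟨k, hk, hik, hjk⟩
    · exact hW₂ i hik j hjk

omit [Fintype ι] [DecidableEq ι] in
/-- **Necessity of the clique conditions** (the trivial half of the completion problem,
[GJSW, §5]): if `A` has a positive semidefinite completion then every fully specified principal
block — in particular every clique block `A[C]` — is positive semidefinite.
[cite: GroneEtAl1984, §5 (definition of a G-partial nonnegative matrix)] -/
theorem posSemidef_submatrix_of_completion {A Z : Matrix ι ι 𝕜} (hZ : Z.PosSemidef) (Cl : Set ι)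
    (hZA : ∀ i ∈ Cl, ∀ j ∈ Cl, Z i j = A i j) :
    (A.submatrix (Subtype.val : Cl → ι) Subtype.val).PosSemidef := by
  have h : A.submatrix (Subtype.val : Cl → ι) (Subtype.val : Cl → ι) =
      Z.submatrix (Subtype.val : Cl → ι) (Subtype.val : Cl → ι) := by
    ext i j
    simp only [Matrix.submatrix_apply]
    exact (hZA i i.2 j j.2).symm
  rw [h]
  exact hZ.submatrix _

/-! ### Block form: one unspecified corner -/

/-- **Two overlapping blocks, display form** ([GJSW, Thm 7] for the chordal pattern with maximal
cliques `α ∪ β`, `β ∪ γ`; the band case is [GJSW, (6.1)] = Dym–Gohberg): if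
`[[A, B], [Bᴴ, X]] ⪰ 0` and `[[X, D], [Dᴴ, E]] ⪰ 0` then some corner `Z` makes
`[[A, B, Z], [Bᴴ, X, D], [Zᴴ, Dᴴ, E]] ⪰ 0`.  (With `X ≻ 0` one may take `Z = B X⁻¹ D`; no
invertibility is assumed here.)
[cite: GroneEtAl1984, Thm 7 ('if') with two maximal cliques; (6.1)] -/
theorem exists_fromBlocks₃_posSemidef {α β γ : Type*} [Fintype α] [Fintype β] [Fintype γ]
    [DecidableEq α] [DecidableEq β] [DecidableEq γ]
    {A : Matrix α α 𝕜} {B : Matrix α β 𝕜} {X : Matrix β β 𝕜} {D : Matrix β γ 𝕜}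
    {E : Matrix γ γ 𝕜} (h₁ : (Matrix.fromBlocks A B Bᴴ X).PosSemidef)
    (h₂ : (Matrix.fromBlocks X D Dᴴ E).PosSemidef) :
    ∃ Z : Matrix α γ 𝕜, (Matrix.fromBlocks A (Matrix.fromCols B Z) (Matrix.fromRows Bᴴ Zᴴ)
      (Matrix.fromBlocks X D Dᴴ E)).PosSemidef := by
  classical
  -- the partial matrix with the corner provisionally set to `0`, on `ι = α ⊕ (β ⊕ γ)`
  let G : Matrix (α ⊕ (β ⊕ γ)) (α ⊕ (β ⊕ γ)) 𝕜 :=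
    Matrix.fromBlocks A (Matrix.fromCols B 0) (Matrix.fromRows Bᴴ 0) (Matrix.fromBlocks X D Dᴴ E)
  let f : α ⊕ β → α ⊕ (β ⊕ γ) := Sum.map id Sum.inl
  let g : β ⊕ γ → α ⊕ (β ⊕ γ) := Sum.inr
  have hf : Function.Injective f := Sum.map_injective.mpr ⟨Function.injective_id, Sum.inl_injective⟩
  have hg : Function.Injective g := Sum.inr_injective
  have hGf : G.submatrix f f = Matrix.fromBlocks A B Bᴴ X := by
    ext (a | b) (a' | b') <;> simp [G, f]
  have hGg : G.submatrix g g = Matrix.fromBlocks X D Dᴴ E := by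
    ext (b | c) (b' | c') <;> simp [G, g]
  have h₁' : (G.submatrix (Subtype.val : Set.range f → _) Subtype.val).PosSemidef := by
    rw [← Matrix.posSemidef_submatrix_equiv (Equiv.ofInjective f hf)]
    have : (G.submatrix (Subtype.val : Set.range f → _) Subtype.val).submatrix
        (Equiv.ofInjective f hf) (Equiv.ofInjective f hf) = G.submatrix f f := by
      ext i j; simp
    rw [this, hGf]; exact h₁
  have h₂' : (G.submatrix (Subtype.val : Set.range g → _) Subtype.val).PosSemidef := by
    rw [← Matrix.posSemidef_submatrix_equiv (Equiv.ofInjective g hg)]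
    have : (G.submatrix (Subtype.val : Set.range g → _) Subtype.val).submatrix
        (Equiv.ofInjective g hg) (Equiv.ofInjective g hg) = G.submatrix g g := by
      ext i j; simp
    rw [this, hGg]; exact h₂
  obtain ⟨W, hW, hW₁, hW₂⟩ :=
    exists_posSemidef_glue (Set.range f) (Set.range g) G G h₁' h₂' (fun _ _ _ _ _ _ => rfl)
  have hαs : ∀ a : α, (Sum.inl a : α ⊕ (β ⊕ γ)) ∈ Set.range f := fun a => ⟨Sum.inl a, rfl⟩
  have hβs : ∀ b : β, (Sum.inr (Sum.inl b) : α ⊕ (β ⊕ γ)) ∈ Set.range f :=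
    fun b => ⟨Sum.inr b, rfl⟩
  have hβt : ∀ b : β, (Sum.inr (Sum.inl b) : α ⊕ (β ⊕ γ)) ∈ Set.range g :=
    fun b => ⟨Sum.inl b, rfl⟩
  have hγt : ∀ c : γ, (Sum.inr (Sum.inr c) : α ⊕ (β ⊕ γ)) ∈ Set.range g :=
    fun c => ⟨Sum.inr c, rfl⟩
  refine ⟨fun a c => W (Sum.inl a) (Sum.inr (Sum.inr c)), ?_⟩
  have hWeq : Matrix.fromBlocks A (Matrix.fromCols B fun a c => W (Sum.inl a) (Sum.inr (Sum.inr c)))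
      (Matrix.fromRows Bᴴ (fun a c => W (Sum.inl a) (Sum.inr (Sum.inr c)))ᴴ)
      (Matrix.fromBlocks X D Dᴴ E) = W := by
    ext (a | (b | c)) (a' | (b' | c'))
    · rw [hW₁ _ (hαs a) _ (hαs a')]; simp [G]
    · rw [hW₁ _ (hαs a) _ (hβs b')]; simp [G]
    · simp
    · rw [hW₁ _ (hβs b) _ (hαs a')]; simp [G]
    · rw [hW₂ _ (hβt b) _ (hβt b')]; simp [G]
    · rw [hW₂ _ (hβt b) _ (hγt c')]; simp [G]
    · simp only [Matrix.fromBlocks_apply₂₁, Matrix.fromRows_apply_inr, Matrix.conjTranspose_apply]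
      exact hW.1.apply _ _
    · rw [hW₂ _ (hγt c) _ (hβt b')]; simp [G]
    · rw [hW₂ _ (hγt c) _ (hγt c')]; simp [G]
  rw [hWeq]
  exact hW

end Literature.Analysis.Matrix.ChordalCompletion

end
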